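import Literature.Geometry.Lorentzian.KerrSharpSupProfiles
import Literature.Geometry.Lorentzian.KerrFlatRangeWeight
import HarnessLib

/-!
# Multipliers for the trapping range `𝓖_♮` (Dafermos–Rodnianski–Shlapentokh-Rothman, Prop. 8.6.1):
# the horizon weight `ŷ`, the virial weight `f`, and a concentration inequality

(family `gr`, infrastructure for statement **gr.S24**; namespace `Literature.Geometry.Lorentzian.Kerr`)

Dafermos–Rodnianski–Shlapentokh-Rothman (*Decay for solutions of the wave equation on Kerr exterior
spacetimes III*, arXiv:1402.7034 = Ann. of Math. 183 (2016)), proof of Prop. 8.6.1 (the trapping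
range `𝓖_♮`, case `r₃ < R_dec`), use the current `Q = Q^f + ϟ^ŷ − EQ^T` with: a virial weight `f`
with `f' > 0` on the region of interest, "`f` switches from negative to positive at `r = r_max`,
`f = 1` for `r* ≥ R*_dec`", `−fV' − ½f''' > bΛΔ(r − r_max)²r⁻⁷` on `[r₃, ∞)` ("In view of the
properties of `V` proven above, such a function can easily be constructed"); and a horizon weight
`ŷ` with "`ŷ = 0` for `r ≥ r₃`, `ŷ' > 0` for `r ≤ r₃`, `|ŷ| + |ŷ'| ≤ B`", for which "it suffices to
fulfil the inequality `dŷ/dr ≥ −ŷC + C`" and "the function `ŷ = 1 − e^{C(r₃ − r)}` satisfies all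
the above criteria". This file supplies these objects explicitly, as functions of `x = r*` along a
tortoise radius function `R` (`KerrTortoiseRadius.lean`), and proves their elementary properties:

* `Kerr.trapRamp ρ θ`, a `C¹` ramp `ψ(r) = (max(ρ + θ − r, 0)² − max(ρ − r, 0)²)/(2θ)`
  (`= ρ + θ/2 − r` for `r ≤ ρ`, `= 0` for `r ≥ ρ + θ`, `−1 ≤ ψ' ≤ 0`), and the **horizon weight**
  `Kerr.trapWeight C ρ θ r = 1 − exp(Cψ(r))` — the printed `1 − e^{C(r₃ − r)}` (up to the
  harmless constant `e^{Cθ/2}`) continued to `0` on `[ρ, ρ + θ]` in a `C¹` way instead of by a kink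
  at `r₃` (`ρ = r₃`; on `[r₃, r₃ + θ]` every term of the bulk is separately non-negative, so the
  continuation costs nothing): `Y ≤ 0`, `Y = 0` for `r ≥ ρ + θ`, `dY/dr ≥ 0`, and the printed
  relation **`dY/dr = C(1 − Y) = C(1 + |Y|)` for `r ≤ ρ`** (`trapWeightDeriv_of_le`);
* `Kerr.trapMultipliers M a c L A₀ A₁ C ρ θ R`: the `Multipliers` record
  (`KerrCombinedCurrent.lean`) with `f(x) = A₀ + A₁Φ((x − c)/L)/I`, `Φ/I` the clipped-linear
  profile of `KerrSharpSupProfiles.lean` (linear on `|x − c| ≤ L`, `= ±1` for `±(x − c) ≥ 2L`,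
  non-decreasing; `A₀ = 0, A₁ = 1`,
  `c = r*(r_max)` in the case `r₃ < R_dec`, `A₀ = A₁ = ½` — a step from `0` to `1` — in the case
  `r₃ ≥ R_dec`), `h = 0`, `y = Y ∘ R`, `χ₂ = 1`, `χ₁ = 0`, with `HasDerivs` and the end limits
  `f → A₀ ± A₁`, `y → 0` (`+∞`), `y → Y(r₊)` (horizon), and the bulk and source of the resulting
  current `Q = Q^f + ϟ^ŷ − EQ^T`;
* a **concentration (interpolation) inequality** supplying the term `+1·|u|²` of the left-hand side
  `b∫(|u'|² + ((ω² + Λ)(1 − r⁻¹r_trap)² + 1)|u|²)` near `r = r_trap`, where the bulk only controls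
  `|u'|² + Λ(r − r_max)²|u|²`: for a `C¹` cut-off `ζ` vanishing at the ends of `[x₁, x₂]`,
  `0 ≤ ζ ≤ 1`, `|ζ'| ≤ K`, and `Λ ≥ 1`,
  `∫ ζ²|u|² ≤ (4K² + 2)∫ Λ(x − c)²|u|² + 2∫ |u'|²` (`integral_cutoff_sq_mul_norm_sq_le`, by
  integrating `(ζ²(x − c)|u|²)'`), and its instance for the plateau cut-off `Kerr.plateauCutoff`
  built from `Kerr.softStep`:
  `∫_{x₁}^{x₂} |u|² ≤ 66∫_{x₁−1}^{x₂+1} Λ(x − c)²|u|² + 2∫_{x₁−1}^{x₂+1} |u'|²`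
  (`integral_norm_sq_le_of_concentration`). This step is implicit in loc. cit.
* Tortoise geometry used to place the profiles (`c = r*(r_max)` exists:
  `IsTortoiseRadius.exists_eq`; `|R(y) − R(x)| ≤ |y − x|` and `R(y) − R(x) ≥ q(R(x))(y − x)`,
  `q = Δ/(r² + a²)` non-decreasing (`delta_div_mono`) with `q(r) ≥ (r − r₊)√(M² − a²)/r²`; and the
  exponential depth bound `(R(c) − r₊)e^{−(c − x)/M} ≤ R(x) − r₊` for `x ≤ c`
  (`IsTortoiseRadius.sub_rPlus_ge`), which bounds `Δ` from below on the transition zone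
  `c − 2L ≤ x ≤ c − L` of `f` where `f''' ≠ 0`).

No named facts (D-0026); everything is proved.

## References

* M. Dafermos, I. Rodnianski, Y. Shlapentokh-Rothman, arXiv:1402.7034 = Ann. of Math. 183
  (2016), §8.6, proof of Prop. 8.6.1 ((choices13)–(choices15), (aSplendidIneq0), (aSplendidIneq))
  (key `DafermosRodnianskiShlapentokhrothman2014`).
-/

noncomputable section

open Set Filter Topology MeasureTheory
open scoped InnerProductSpace

namespace Literature.Geometry.Lorentzian

namespace Kerr

/-! ### A concentration inequality: `∫ζ²|u|² ≤ C∫(Λ(x − c)²|u|² + |u'|²)` -/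

section Concentration

variable {F : Type*} [NormedAddCommGroup F] [InnerProductSpace ℝ F]

/-- **Concentration inequality, abstract cut-off form.** Let `u` be `C¹` on `ℝ` with values in a
real inner product space, `ζ` a `C¹` real function with `0 ≤ ζ ≤ 1`, `|ζ'| ≤ K`, vanishing at `x₁`
and at `x₂` (`x₁ ≤ x₂`), `c ∈ ℝ` and `Λ ≥ 1`. Then
`∫_{x₁}^{x₂} ζ²|u|² ≤ (4K² + 2)∫_{x₁}^{x₂} Λ(x − c)²|u|² + 2∫_{x₁}^{x₂} |u'|²`.
Proof: integrate `d/dx(ζ²(x − c)|u|²) = 2ζζ'(x − c)|u|² + ζ²|u|² + 2ζ²(x − c)⟪u, u'⟫` over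
`[x₁, x₂]` (the boundary terms vanish) and use `2ζζ'(x − c) ≥ −½ζ² − 2ζ'²(x − c)²`,
`2|x − c||u||u'| ≤ Λ(x − c)²|u|² + Λ⁻¹|u'|²`. (The `|u|²`-control near `r_trap` in DRSR
arXiv:1402.7034, Prop. 8.6.1, where the bulk degenerates like `Λ(r − r_max)²`.) [folklore] -/
theorem integral_cutoff_sq_mul_norm_sq_le {u u' : ℝ → F} {ζ ζ' : ℝ → ℝ} {x₁ x₂ c Λ K : ℝ}
    (hx : x₁ ≤ x₂) (hΛ : 1 ≤ Λ) (hu : ∀ x, HasDerivAt u (u' x) x) (hu' : Continuous u')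
    (hζ : ∀ x, HasDerivAt ζ (ζ' x) x) (hζ' : Continuous ζ') (hζ0 : ∀ x, 0 ≤ ζ x)
    (hζ1 : ∀ x, ζ x ≤ 1) (hK : ∀ x, |ζ' x| ≤ K) (hζx₁ : ζ x₁ = 0) (hζx₂ : ζ x₂ = 0) :
    ∫ x in x₁..x₂, ζ x ^ 2 * ‖u x‖ ^ 2 ≤
      (4 * K ^ 2 + 2) * (∫ x in x₁..x₂, Λ * (x - c) ^ 2 * ‖u x‖ ^ 2) +
        2 * ∫ x in x₁..x₂, ‖u' x‖ ^ 2 := by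
  have hΛ0 : 0 < Λ := one_pos.trans_le hΛ
  have huc : Continuous u := continuous_iff_continuousAt.2 fun x ↦ (hu x).continuousAt
  have hζc : Continuous ζ := continuous_iff_continuousAt.2 fun x ↦ (hζ x).continuousAt
  -- the auxiliary function `Φ = ζ²(x − c)|u|²` and its derivative
  set Φ : ℝ → ℝ := fun x ↦ ζ x ^ 2 * (x - c) * ‖u x‖ ^ 2 with hΦ
  set Φ' : ℝ → ℝ := fun x ↦ 2 * ζ x * ζ' x * (x - c) * ‖u x‖ ^ 2 + ζ x ^ 2 * ‖u x‖ ^ 2 +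
    ζ x ^ 2 * (x - c) * (2 * ⟪u x, u' x⟫_ℝ) with hΦ'
  have hderiv : ∀ x, HasDerivAt Φ (Φ' x) x := by
    intro x
    have h1 : HasDerivAt (fun x ↦ ζ x ^ 2) (2 * ζ x * ζ' x) x := by
      have h := (hζ x).pow 2
      exact h.congr_deriv (by simp)
    have h2 : HasDerivAt (fun x : ℝ ↦ x - c) 1 x := (hasDerivAt_id x).sub_const c
    have h3 : HasDerivAt (fun x ↦ ‖u x‖ ^ 2) (2 * ⟪u x, u' x⟫_ℝ) x := (hu x).norm_sq
    have h := (h1.mul h2).mul h3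
    refine h.congr_deriv ?_
    simp only [hΦ', Pi.mul_apply]
    ring
  have hΦ'c : Continuous Φ' := by
    have h3 : Continuous fun x ↦ ⟪u x, u' x⟫_ℝ := huc.inner hu'
    simp only [hΦ']
    fun_prop
  -- `∫ Φ' = Φ(x₂) − Φ(x₁) = 0`
  have hFTC : ∫ x in x₁..x₂, Φ' x = 0 := by
    rw [intervalIntegral.integral_eq_sub_of_hasDerivAt (fun x _ ↦ hderiv x)
      (hΦ'c.intervalIntegrable _ _)]
    simp [hΦ, hζx₁, hζx₂]
  -- the pointwise inequality
  have hpt : ∀ x, 1 / 2 * (ζ x ^ 2 * ‖u x‖ ^ 2) ≤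
      Φ' x + (2 * K ^ 2 + Λ) * ((x - c) ^ 2 * ‖u x‖ ^ 2) + 1 / Λ * ‖u' x‖ ^ 2 := by
    intro x
    have hN : 0 ≤ ‖u x‖ ^ 2 := by positivity
    have hz0 := hζ0 x
    have hz1 := hζ1 x
    have hKx := hK x
    have hK0 : 0 ≤ K := (abs_nonneg _).trans hKx
    have hz2 : ζ x ^ 2 ≤ 1 := by nlinarith only [hz0, hz1]
    have hζ'2 : ζ' x ^ 2 ≤ K ^ 2 := by
      have h := sq_abs (ζ' x)
      nlinarith only [hKx, abs_nonneg (ζ' x), h, hK0]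
    -- group 1: `½ζ²N + 2ζζ'(x − c)N + 2K²(x − c)²N ≥ 0`
    have e1 : ‖u x‖ ^ 2 / 2 * (ζ x + 2 * ζ' x * (x - c)) ^ 2 =
        1 / 2 * (ζ x ^ 2 * ‖u x‖ ^ 2) + 2 * ζ x * ζ' x * (x - c) * ‖u x‖ ^ 2 +
          2 * (ζ' x ^ 2 * ((x - c) ^ 2 * ‖u x‖ ^ 2)) := by ring
    have g1a : 0 ≤ ‖u x‖ ^ 2 / 2 * (ζ x + 2 * ζ' x * (x - c)) ^ 2 := by positivity
    have g1b : 0 ≤ (K ^ 2 - ζ' x ^ 2) * ((x - c) ^ 2 * ‖u x‖ ^ 2) :=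
      mul_nonneg (sub_nonneg.2 hζ'2) (by positivity)
    -- group 2: `2ζ²(x − c)⟪u, u'⟫ + Λ(x − c)²N + Λ⁻¹|u'|² ≥ 0`
    have hI : |⟪u x, u' x⟫_ℝ| ≤ ‖u x‖ * ‖u' x‖ := abs_real_inner_le_norm _ _
    set P := |x - c| * ‖u x‖ with hP
    set Q := ‖u' x‖ with hQ
    have hP0 : 0 ≤ P := by positivity
    have hQ0 : 0 ≤ Q := by positivity
    have hP2 : P ^ 2 = (x - c) ^ 2 * ‖u x‖ ^ 2 := by rw [hP, mul_pow, sq_abs]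
    have g2a : -(2 * P * Q) ≤ 2 * ((x - c) * ⟪u x, u' x⟫_ℝ) := by
      have h1 : |(x - c) * ⟪u x, u' x⟫_ℝ| ≤ P * Q := by
        rw [abs_mul, hP, mul_assoc]
        exact mul_le_mul_of_nonneg_left hI (abs_nonneg _)
      linarith only [h1, neg_abs_le ((x - c) * ⟪u x, u' x⟫_ℝ)]
    have g2b : 2 * P * Q ≤ Λ * P ^ 2 + 1 / Λ * Q ^ 2 := by
      have h : 0 ≤ (Λ * P - Q) ^ 2 / Λ := by positivity
      have e : (Λ * P - Q) ^ 2 / Λ = Λ * P ^ 2 + 1 / Λ * Q ^ 2 - 2 * P * Q := by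
        field_simp; ring
      linarith only [h, e.le, e.ge]
    have g2c : ζ x ^ 2 * (2 * ((x - c) * ⟪u x, u' x⟫_ℝ)) ≥ -(2 * P * Q) := by
      -- `ζ² ∈ [0, 1]` and `2(x − c)⟪u, u'⟫ ≥ −2PQ` with `2PQ ≥ 0`
      have h2 : 0 ≤ 2 * P * Q := by positivity
      nlinarith only [g2a, h2, hz2, sq_nonneg (ζ x)]
    have e2 : Φ' x = 2 * ζ x * ζ' x * (x - c) * ‖u x‖ ^ 2 + ζ x ^ 2 * ‖u x‖ ^ 2 +
        ζ x ^ 2 * (2 * ((x - c) * ⟪u x, u' x⟫_ℝ)) := by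
      simp only [hΦ']; ring
    rw [e2, hQ] at *
    rw [← hP2]
    nlinarith only [e1, g1a, g1b, g2b, g2c, hP2]
  -- integrate the pointwise inequality over `[x₁, x₂]`
  have hI₂ : 0 ≤ ∫ x in x₁..x₂, (x - c) ^ 2 * ‖u x‖ ^ 2 :=
    intervalIntegral.integral_nonneg hx fun x _ ↦ by positivity
  have hI₃ : 0 ≤ ∫ x in x₁..x₂, ‖u' x‖ ^ 2 :=
    intervalIntegral.integral_nonneg hx fun x _ ↦ by positivity
  have hic : Continuous fun x ↦ ⟪u x, u' x⟫_ℝ := huc.inner hu'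
  have hi0 : IntervalIntegrable (fun x ↦ 1 / 2 * (ζ x ^ 2 * ‖u x‖ ^ 2)) volume x₁ x₂ := by
    apply Continuous.intervalIntegrable; fun_prop
  have hi1 : IntervalIntegrable (fun x ↦ Φ' x + (2 * K ^ 2 + Λ) * ((x - c) ^ 2 * ‖u x‖ ^ 2))
      volume x₁ x₂ := by
    apply Continuous.intervalIntegrable; fun_prop
  have hi2 : IntervalIntegrable (fun x ↦ 1 / Λ * ‖u' x‖ ^ 2) volume x₁ x₂ := by
    apply Continuous.intervalIntegrable; fun_prop
  have hi3 : IntervalIntegrable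
      (fun x ↦ Φ' x + (2 * K ^ 2 + Λ) * ((x - c) ^ 2 * ‖u x‖ ^ 2) + 1 / Λ * ‖u' x‖ ^ 2)
      volume x₁ x₂ := by
    apply Continuous.intervalIntegrable; fun_prop
  have hi4 : IntervalIntegrable Φ' volume x₁ x₂ := hΦ'c.intervalIntegrable _ _
  have hi5 : IntervalIntegrable (fun x ↦ (2 * K ^ 2 + Λ) * ((x - c) ^ 2 * ‖u x‖ ^ 2))
      volume x₁ x₂ := by
    apply Continuous.intervalIntegrable; fun_prop
  have hmono : ∫ x in x₁..x₂, 1 / 2 * (ζ x ^ 2 * ‖u x‖ ^ 2) ≤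
      ∫ x in x₁..x₂, (Φ' x + (2 * K ^ 2 + Λ) * ((x - c) ^ 2 * ‖u x‖ ^ 2) + 1 / Λ * ‖u' x‖ ^ 2) :=
    intervalIntegral.integral_mono_on hx hi0 hi3 (fun x _ ↦ hpt x)
  rw [intervalIntegral.integral_add hi1 hi2, intervalIntegral.integral_add hi4 hi5,
    intervalIntegral.integral_const_mul, intervalIntegral.integral_const_mul,
    intervalIntegral.integral_const_mul, hFTC] at hmono
  -- `∫ Λ(x − c)²|u|² = Λ ∫ (x − c)²|u|²`
  have hΛg₂ : ∫ x in x₁..x₂, Λ * (x - c) ^ 2 * ‖u x‖ ^ 2 =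
      Λ * ∫ x in x₁..x₂, (x - c) ^ 2 * ‖u x‖ ^ 2 := by
    rw [← intervalIntegral.integral_const_mul]
    refine intervalIntegral.integral_congr fun x _ ↦ ?_
    ring
  have h1 : 2 * ((2 * K ^ 2 + Λ) * ∫ x in x₁..x₂, (x - c) ^ 2 * ‖u x‖ ^ 2) ≤
      (4 * K ^ 2 + 2) * (Λ * ∫ x in x₁..x₂, (x - c) ^ 2 * ‖u x‖ ^ 2) := by
    have : 2 * (2 * K ^ 2 + Λ) ≤ (4 * K ^ 2 + 2) * Λ := by nlinarith only [hΛ, sq_nonneg K]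
    nlinarith only [this, hI₂]
  have h2 : 2 * (1 / Λ * ∫ x in x₁..x₂, ‖u' x‖ ^ 2) ≤ 2 * ∫ x in x₁..x₂, ‖u' x‖ ^ 2 := by
    have : 1 / Λ ≤ 1 := by rw [div_le_one hΛ0]; exact hΛ
    nlinarith only [this, hI₃]
  have hfin : ∫ x in x₁..x₂, ζ x ^ 2 * ‖u x‖ ^ 2 ≤
      (4 * K ^ 2 + 2) * (Λ * ∫ x in x₁..x₂, (x - c) ^ 2 * ‖u x‖ ^ 2) +
        2 * ∫ x in x₁..x₂, ‖u' x‖ ^ 2 := by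
    linarith only [hmono, h1, h2]
  rw [hΛg₂]
  exact hfin

/-- **The plateau cut-off** `ζ(x) = ψ(x − x₁ + 1) ψ(x₂ + 1 − x)` (`ψ = Kerr.softStep`): `C¹`,
`0 ≤ ζ ≤ 1`, `ζ = 1` on `[x₁, x₂]`, `ζ = 0` at `x₁ − 1` and at `x₂ + 1`, `|ζ'| ≤ 4`. [folklore] -/
def plateauCutoff (x₁ x₂ x : ℝ) : ℝ := softStep (x - x₁ + 1) * softStep (x₂ + 1 - x)

/-- `ζ'`. [folklore] -/
def plateauCutoffDeriv (x₁ x₂ x : ℝ) : ℝ :=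
  softStepDeriv (x - x₁ + 1) * softStep (x₂ + 1 - x) -
    softStep (x - x₁ + 1) * softStepDeriv (x₂ + 1 - x)

/-- `ζ' ` is the derivative of `ζ`. [folklore] -/
theorem hasDerivAt_plateauCutoff (x₁ x₂ x : ℝ) :
    HasDerivAt (plateauCutoff x₁ x₂) (plateauCutoffDeriv x₁ x₂ x) x := by
  have h1 : HasDerivAt (fun x ↦ softStep (x - x₁ + 1)) (softStepDeriv (x - x₁ + 1)) x := by
    have h := (hasDerivAt_softStep (x - x₁ + 1)).comp x
      (((hasDerivAt_id x).sub_const x₁).add_const 1)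
    simpa [Function.comp_def] using h
  have h2 : HasDerivAt (fun x ↦ softStep (x₂ + 1 - x)) (-softStepDeriv (x₂ + 1 - x)) x := by
    have h := (hasDerivAt_softStep (x₂ + 1 - x)).comp x
      ((hasDerivAt_const x (x₂ + 1)).sub (hasDerivAt_id x))
    have h' : HasDerivAt (softStep ∘ fun x ↦ x₂ + 1 - id x)
        (softStepDeriv (x₂ + 1 - x) * (0 - 1)) x := h
    refine (h'.congr_deriv (by ring)).congr_of_eventuallyEq (Eventually.of_forall fun s ↦ ?_)
    simp
  exact (h1.mul h2).congr_deriv (by unfold plateauCutoffDeriv; ring)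

/-- `0 ≤ ζ ≤ 1`. [folklore] -/
theorem plateauCutoff_mem_Icc (x₁ x₂ x : ℝ) : plateauCutoff x₁ x₂ x ∈ Icc (0 : ℝ) 1 := by
  have h1 := softStep_mem_Icc (x - x₁ + 1)
  have h2 := softStep_mem_Icc (x₂ + 1 - x)
  unfold plateauCutoff
  exact ⟨mul_nonneg h1.1 h2.1, mul_le_one₀ h1.2 h2.1 h2.2⟩

/-- `ζ = 1` on `[x₁, x₂]`. [folklore] -/
theorem plateauCutoff_eq_one {x₁ x₂ x : ℝ} (hx : x ∈ Icc x₁ x₂) : plateauCutoff x₁ x₂ x = 1 := by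
  unfold plateauCutoff
  rw [softStep_of_one_le (by linarith [hx.1]), softStep_of_one_le (by linarith [hx.2]), mul_one]

/-- `ζ(x₁ − 1) = 0`. [folklore] -/
theorem plateauCutoff_left (x₁ x₂ : ℝ) : plateauCutoff x₁ x₂ (x₁ - 1) = 0 := by
  unfold plateauCutoff
  rw [softStep_of_nonpos (by linarith), zero_mul]

/-- `ζ(x₂ + 1) = 0`. [folklore] -/
theorem plateauCutoff_right (x₁ x₂ : ℝ) : plateauCutoff x₁ x₂ (x₂ + 1) = 0 := by
  unfold plateauCutoff
  rw [softStep_of_nonpos (show x₂ + 1 - (x₂ + 1) ≤ 0 by linarith), mul_zero]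

/-- `|ζ'| ≤ 4`. [folklore] -/
theorem abs_plateauCutoffDeriv_le (x₁ x₂ x : ℝ) : |plateauCutoffDeriv x₁ x₂ x| ≤ 4 := by
  have h1 := softStep_mem_Icc (x - x₁ + 1)
  have h2 := softStep_mem_Icc (x₂ + 1 - x)
  have h3 := softStepDeriv_mem_Icc (x - x₁ + 1)
  have h4 := softStepDeriv_mem_Icc (x₂ + 1 - x)
  unfold plateauCutoffDeriv
  rw [abs_le]
  constructor <;> nlinarith [h1.1, h1.2, h2.1, h2.2, h3.1, h3.2, h4.1, h4.2]

/-- `ζ'` is continuous. [folklore] -/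
theorem continuous_plateauCutoffDeriv (x₁ x₂ : ℝ) : Continuous (plateauCutoffDeriv x₁ x₂) := by
  unfold plateauCutoffDeriv
  have := continuous_softStep
  have := continuous_softStepDeriv
  fun_prop

/-- **Concentration inequality for an interval** (`Λ ≥ 1`, `x₁ ≤ x₂`, any centre `c`): for `u`
of class `C¹` on `ℝ`,
`∫_{x₁}^{x₂} |u|² ≤ 66 ∫_{x₁−1}^{x₂+1} Λ(x − c)²|u|² + 2 ∫_{x₁−1}^{x₂+1} |u'|²`
(the abstract inequality for `ζ = plateauCutoff x₁ x₂` on `[x₁ − 1, x₂ + 1]`, `K = 4`). This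
converts the control of `|u'|² + Λ(r − r_max)²|u|²` furnished by the bulk of the `𝓖_♮`-current into the
`+1·|u|²` of the left-hand side of DRSR arXiv:1402.7034, Prop. 8.6.1. [folklore] -/
theorem integral_norm_sq_le_of_concentration {u u' : ℝ → F} {x₁ x₂ c Λ : ℝ} (hx : x₁ ≤ x₂)
    (hΛ : 1 ≤ Λ) (hu : ∀ x, HasDerivAt u (u' x) x) (hu' : Continuous u') :
    ∫ x in x₁..x₂, ‖u x‖ ^ 2 ≤
      66 * (∫ x in (x₁ - 1)..(x₂ + 1), Λ * (x - c) ^ 2 * ‖u x‖ ^ 2) +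
        2 * ∫ x in (x₁ - 1)..(x₂ + 1), ‖u' x‖ ^ 2 := by
  have huc : Continuous u := continuous_iff_continuousAt.2 fun x ↦ (hu x).continuousAt
  have hζc : Continuous (plateauCutoff x₁ x₂) :=
    continuous_iff_continuousAt.2 fun x ↦ (hasDerivAt_plateauCutoff x₁ x₂ x).continuousAt
  have h := integral_cutoff_sq_mul_norm_sq_le (c := c) (K := 4) (by linarith : x₁ - 1 ≤ x₂ + 1) hΛ
    hu hu' (hasDerivAt_plateauCutoff x₁ x₂) (continuous_plateauCutoffDeriv x₁ x₂)
    (fun x ↦ (plateauCutoff_mem_Icc x₁ x₂ x).1) (fun x ↦ (plateauCutoff_mem_Icc x₁ x₂ x).2)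
    (abs_plateauCutoffDeriv_le x₁ x₂) (plateauCutoff_left x₁ x₂) (plateauCutoff_right x₁ x₂)
  -- `∫_{x₁}^{x₂} |u|² ≤ ∫_{x₁−1}^{x₂+1} ζ²|u|²`
  have hle : ∫ x in x₁..x₂, ‖u x‖ ^ 2 ≤
      ∫ x in (x₁ - 1)..(x₂ + 1), plateauCutoff x₁ x₂ x ^ 2 * ‖u x‖ ^ 2 := by
    have heq : ∫ x in x₁..x₂, ‖u x‖ ^ 2 = ∫ x in x₁..x₂, plateauCutoff x₁ x₂ x ^ 2 * ‖u x‖ ^ 2 := by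
      refine intervalIntegral.integral_congr fun x hy ↦ ?_
      rw [uIcc_of_le hx] at hy
      simp [plateauCutoff_eq_one hy]
    rw [heq]
    exact intervalIntegral.integral_mono_interval (by linarith) hx (by linarith)
      (Eventually.of_forall fun x ↦ by positivity)
      (((hζc.pow 2).mul (huc.norm.pow 2)).intervalIntegrable _ _)
  have e : (4 * (4 : ℝ) ^ 2 + 2) = 66 := by norm_num
  rw [e] at h
  exact hle.trans h

end Concentration


/-! ### The `C¹` ramp `ψ` and the horizon weight `Y = 1 − exp(Cψ)` -/

section Weight

variable {C ρ θ r : ℝ}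

/-- The ramp `ψ(r) = (max(ρ + θ − r, 0)² − max(ρ − r, 0)²)/(2θ)`: `= ρ + θ/2 − r` for `r ≤ ρ`,
`= 0` for `r ≥ ρ + θ`, `C¹` with `−1 ≤ ψ' ≤ 0`. [folklore] -/
def trapRamp (ρ θ r : ℝ) : ℝ := (max (ρ + θ - r) 0 ^ 2 - max (ρ - r) 0 ^ 2) / (2 * θ)

/-- `ψ'(r) = −(max(ρ + θ − r, 0) − max(ρ − r, 0))/θ`. [folklore] -/
def trapRampDeriv (ρ θ r : ℝ) : ℝ := -((max (ρ + θ - r) 0 - max (ρ - r) 0) / θ)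

/-- `ψ'` is the derivative of `ψ`. [folklore] -/
theorem hasDerivAt_trapRamp (ρ θ r : ℝ) : HasDerivAt (trapRamp ρ θ) (trapRampDeriv ρ θ r) r := by
  have h := ((hasDerivAt_max_sub_zero_sq (ρ + θ) r).sub (hasDerivAt_max_sub_zero_sq ρ r)).div_const
    (2 * θ)
  refine h.congr_deriv ?_
  unfold trapRampDeriv
  rcases eq_or_ne θ 0 with hθ | hθ
  · subst hθ; simp
  · field_simp
    ring

/-- `ψ = ρ + θ/2 − r` for `r ≤ ρ` (`θ > 0`). [folklore] -/
theorem trapRamp_of_le (hθ : 0 < θ) (h : r ≤ ρ) : trapRamp ρ θ r = ρ + θ / 2 - r := by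
  unfold trapRamp
  rw [max_eq_left (by linarith), max_eq_left (by linarith)]
  field_simp
  ring

/-- `ψ = 0` for `r ≥ ρ + θ`. [folklore] -/
theorem trapRamp_of_ge (h : ρ + θ ≤ r) (hθ : 0 ≤ θ) : trapRamp ρ θ r = 0 := by
  unfold trapRamp
  rw [max_eq_right (by linarith), max_eq_right (by linarith)]
  simp

/-- `ψ' = −1` for `r ≤ ρ` (`θ > 0`). [folklore] -/
theorem trapRampDeriv_of_le (hθ : 0 < θ) (h : r ≤ ρ) : trapRampDeriv ρ θ r = -1 := by
  unfold trapRampDeriv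
  rw [max_eq_left (by linarith), max_eq_left (by linarith)]
  field_simp
  ring

/-- `ψ' = 0` for `r ≥ ρ + θ` (`θ ≥ 0`). [folklore] -/
theorem trapRampDeriv_of_ge (h : ρ + θ ≤ r) (hθ : 0 ≤ θ) : trapRampDeriv ρ θ r = 0 := by
  unfold trapRampDeriv
  rw [max_eq_right (by linarith), max_eq_right (by linarith)]
  simp

/-- `−1 ≤ ψ' ≤ 0` (`θ > 0`). [folklore] -/
theorem trapRampDeriv_mem_Icc (hθ : 0 < θ) (ρ r : ℝ) : trapRampDeriv ρ θ r ∈ Icc (-1 : ℝ) 0 := by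
  unfold trapRampDeriv
  have h1 : max (ρ - r) 0 ≤ max (ρ + θ - r) 0 := max_le_max (by linarith) le_rfl
  have h2 : max (ρ + θ - r) 0 ≤ max (ρ - r) 0 + θ := by
    rcases le_or_gt (ρ - r) 0 with h | h
    · rw [max_eq_right h]
      exact max_le (by linarith) (by linarith)
    · rw [max_eq_left h.le]
      exact max_le (by linarith) (by linarith)
  constructor
  · rw [le_neg, neg_neg, div_le_one hθ]; linarith
  · rw [neg_nonpos]; exact div_nonneg (sub_nonneg.2 h1) hθ.le

/-- `0 ≤ ψ` (`θ > 0`). [folklore] -/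
theorem trapRamp_nonneg (hθ : 0 < θ) (ρ r : ℝ) : 0 ≤ trapRamp ρ θ r := by
  unfold trapRamp
  have h1 : max (ρ - r) 0 ≤ max (ρ + θ - r) 0 := max_le_max (by linarith) le_rfl
  have h0 : 0 ≤ max (ρ - r) 0 := le_max_right _ _
  exact div_nonneg (by nlinarith) (by linarith)

/-- `ψ ≤ ρ + θ − r⁻ …`: precisely `ψ(r) ≤ ψ(s)` for `s ≤ r` (`ψ` is non-increasing, `θ > 0`).
[folklore] -/
theorem trapRamp_antitone (hθ : 0 < θ) (ρ : ℝ) : Antitone (trapRamp ρ θ) :=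
  antitone_of_deriv_nonpos (fun r ↦ (hasDerivAt_trapRamp ρ θ r).differentiableAt) fun r ↦ by
    rw [(hasDerivAt_trapRamp ρ θ r).deriv]
    exact (trapRampDeriv_mem_Icc hθ ρ r).2

/-- `ψ` is continuous. [folklore] -/
theorem continuous_trapRamp (ρ θ : ℝ) : Continuous (trapRamp ρ θ) :=
  continuous_iff_continuousAt.2 fun r ↦ (hasDerivAt_trapRamp ρ θ r).continuousAt

/-- `ψ'` is continuous. [folklore] -/
theorem continuous_trapRampDeriv (ρ θ : ℝ) : Continuous (trapRampDeriv ρ θ) := by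
  unfold trapRampDeriv; fun_prop

/-- **The horizon weight** `Y(r) = 1 − exp(Cψ(r))` (`ψ = trapRamp ρ θ`): the function
`ŷ = 1 − e^{C(r₃ − r)}` of DRSR arXiv:1402.7034, proof of Prop. 8.6.1 (with `ρ = r₃`, up to the
constant factor `e^{Cθ/2}` in `1 − Y`, and continued to `0` on `[ρ, ρ + θ]` in a `C¹` way).
[cite: DafermosRodnianskiShlapentokhrothman2014, Prop. 8.6.1 (proof)] -/
def trapWeight (C ρ θ r : ℝ) : ℝ := 1 - Real.exp (C * trapRamp ρ θ r)

/-- `dY/dr = −Cψ' exp(Cψ)`. [folklore] -/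
def trapWeightDeriv (C ρ θ r : ℝ) : ℝ := -(C * trapRampDeriv ρ θ r * Real.exp (C * trapRamp ρ θ r))

/-- `dY/dr` is the derivative of `Y`. [folklore] -/
theorem hasDerivAt_trapWeight (C ρ θ r : ℝ) :
    HasDerivAt (trapWeight C ρ θ) (trapWeightDeriv C ρ θ r) r := by
  have h := (((hasDerivAt_trapRamp ρ θ r).const_mul C).exp).const_sub 1
  refine h.congr_deriv ?_
  unfold trapWeightDeriv
  ring

/-- `1 − Y = exp(Cψ)`. [folklore] -/
theorem one_sub_trapWeight (C ρ θ r : ℝ) :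
    1 - trapWeight C ρ θ r = Real.exp (C * trapRamp ρ θ r) := by
  unfold trapWeight; ring

/-- `Y ≤ 0` (`C ≥ 0`, `θ > 0`: `Cψ ≥ 0`). [folklore] -/
theorem trapWeight_nonpos (hC : 0 ≤ C) (hθ : 0 < θ) (ρ r : ℝ) : trapWeight C ρ θ r ≤ 0 := by
  unfold trapWeight
  have : 1 ≤ Real.exp (C * trapRamp ρ θ r) :=
    Real.one_le_exp (mul_nonneg hC (trapRamp_nonneg hθ ρ r))
  linarith

/-- `Y = 0` for `r ≥ ρ + θ`. [folklore] -/
theorem trapWeight_of_ge (h : ρ + θ ≤ r) (hθ : 0 ≤ θ) (C : ℝ) : trapWeight C ρ θ r = 0 := by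
  unfold trapWeight; rw [trapRamp_of_ge h hθ]; simp

/-- `dY/dr = 0` for `r ≥ ρ + θ`. [folklore] -/
theorem trapWeightDeriv_of_ge (h : ρ + θ ≤ r) (hθ : 0 ≤ θ) (C : ℝ) :
    trapWeightDeriv C ρ θ r = 0 := by
  unfold trapWeightDeriv; rw [trapRampDeriv_of_ge h hθ]; simp

/-- **`dY/dr = C(1 − Y)` for `r ≤ ρ`** — the relation "`dŷ/dr ≥ −ŷC + C`" ((aSplendidIneq)) of
DRSR arXiv:1402.7034, proof of Prop. 8.6.1, with equality.
[cite: DafermosRodnianskiShlapentokhrothman2014, Prop. 8.6.1 (proof)] -/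
theorem trapWeightDeriv_of_le (hθ : 0 < θ) (h : r ≤ ρ) (C : ℝ) :
    trapWeightDeriv C ρ θ r = C * (1 - trapWeight C ρ θ r) := by
  unfold trapWeightDeriv
  rw [trapRampDeriv_of_le hθ h, one_sub_trapWeight]
  ring

/-- `dY/dr ≥ 0` (`C ≥ 0`, `θ > 0`). [folklore] -/
theorem trapWeightDeriv_nonneg (hC : 0 ≤ C) (hθ : 0 < θ) (ρ r : ℝ) :
    0 ≤ trapWeightDeriv C ρ θ r := by
  unfold trapWeightDeriv
  have h1 := (trapRampDeriv_mem_Icc hθ ρ r).2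
  have h2 := Real.exp_pos (C * trapRamp ρ θ r)
  have : C * trapRampDeriv ρ θ r * Real.exp (C * trapRamp ρ θ r) ≤ 0 :=
    mul_nonpos_of_nonpos_of_nonneg (mul_nonpos_of_nonneg_of_nonpos hC h1) h2.le
  linarith

/-- `dY/dr ≤ C(1 − Y)` everywhere (`C ≥ 0`, `θ > 0`; `|ψ'| ≤ 1`). [folklore] -/
theorem trapWeightDeriv_le (hC : 0 ≤ C) (hθ : 0 < θ) (ρ r : ℝ) :
    trapWeightDeriv C ρ θ r ≤ C * (1 - trapWeight C ρ θ r) := by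
  rw [one_sub_trapWeight]
  unfold trapWeightDeriv
  have h1 := (trapRampDeriv_mem_Icc hθ ρ r).1
  have h2 := Real.exp_pos (C * trapRamp ρ θ r)
  nlinarith [mul_nonneg hC h2.le]

/-- `1 ≤ 1 − Y ≤ exp(C(ρ + θ/2 − s))` for `s ≤ r`, `s ≤ ρ` (`C ≥ 0`, `θ > 0`): the size of the
weight is controlled by its value at the horizon ("`|ŷ| + |ŷ'| ≤ B(ε_width)`"). [folklore] -/
theorem one_sub_trapWeight_mem_Icc (hC : 0 ≤ C) (hθ : 0 < θ) {s : ℝ} (hs : s ≤ ρ) (hsr : s ≤ r) :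
    1 - trapWeight C ρ θ r ∈ Icc (1 : ℝ) (Real.exp (C * (ρ + θ / 2 - s))) := by
  rw [one_sub_trapWeight]
  refine ⟨Real.one_le_exp (mul_nonneg hC (trapRamp_nonneg hθ ρ r)), ?_⟩
  rw [Real.exp_le_exp, ← trapRamp_of_le hθ hs]
  exact mul_le_mul_of_nonneg_left (trapRamp_antitone hθ ρ hsr) hC

/-- `Y` is continuous. [folklore] -/
theorem continuous_trapWeight (C ρ θ : ℝ) : Continuous (trapWeight C ρ θ) :=
  continuous_iff_continuousAt.2 fun r ↦ (hasDerivAt_trapWeight C ρ θ r).continuousAt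

/-- `dY/dr` is continuous. [folklore] -/
theorem continuous_trapWeightDeriv (C ρ θ : ℝ) : Continuous (trapWeightDeriv C ρ θ) := by
  unfold trapWeightDeriv
  have := continuous_trapRamp ρ θ
  have := continuous_trapRampDeriv ρ θ
  fun_prop

end Weight

/-! ### Tortoise geometry: `q = Δ/(r² + a²)` and comparison of `r*`- and `r`-distances -/

section Tortoise

variable {M a : ℝ} {R : ℝ → ℝ}

/-- **`q(r) = Δ(r)/(r² + a²) = dR/dr*` is non-decreasing in `r`** on `r ≥ s > 0`, `s ≥ |a|`,
`M ≥ 0`: `q(r) − q(s) = 2M(r − s)(rs − a²)/((r² + a²)(s² + a²)) ≥ 0`. [folklore] -/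
theorem delta_div_mono (hM : 0 ≤ M) {s r : ℝ} (hs : 0 < s) (has : |a| ≤ s) (hsr : s ≤ r) :
    delta M a s / (s ^ 2 + a ^ 2) ≤ delta M a r / (r ^ 2 + a ^ 2) := by
  have hr : 0 < r := hs.trans_le hsr
  have ha2 : a ^ 2 ≤ s ^ 2 := by nlinarith [sq_abs a, abs_nonneg a]
  rw [div_le_div_iff₀ (by positivity) (by positivity)]
  unfold delta
  have key : (r ^ 2 - 2 * M * r + a ^ 2) * (s ^ 2 + a ^ 2) -
      (s ^ 2 - 2 * M * s + a ^ 2) * (r ^ 2 + a ^ 2) = 2 * M * (r - s) * (r * s - a ^ 2) := by ring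
  have h1 : 0 ≤ 2 * M * (r - s) * (r * s - a ^ 2) := by
    apply mul_nonneg (mul_nonneg (by positivity) (sub_nonneg.2 hsr))
    nlinarith
  linarith

/-- **`q(r) ≥ (r − r₊)√(M² − a²)/r²`** for `r ≥ r₊` (`|a| < M`):
`Δ = (r − r₊)(r − r₋) ≥ (r − r₊)(r₊ − r₋)`, `r₊ − r₋ = 2√(M² − a²)`, `r² + a² ≤ 2r²`. [folklore] -/
theorem delta_div_ge (hMa : IsSubextremal M a) {r : ℝ} (hr : rPlus M a ≤ r) :
    (r - rPlus M a) * √(M ^ 2 - a ^ 2) / r ^ 2 ≤ delta M a r / (r ^ 2 + a ^ 2) := by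
  have hM := hMa.pos
  have haM : |a| ≤ M := le_of_lt hMa
  have hrM : M ≤ r := (M_le_rPlus M a).trans hr
  have hr0 : 0 < r := hM.trans_le hrM
  have ha2 : a ^ 2 ≤ r ^ 2 := by nlinarith [sq_abs a, abs_nonneg a]
  have hsq : 0 ≤ √(M ^ 2 - a ^ 2) := Real.sqrt_nonneg _
  have hΔ : (r - rPlus M a) * (2 * √(M ^ 2 - a ^ 2)) ≤ delta M a r := by
    rw [delta_eq_mul haM]
    apply mul_le_mul_of_nonneg_left _ (sub_nonneg.2 hr)
    unfold rPlus rMinus at *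
    linarith
  rw [div_le_div_iff₀ (by positivity) (by positivity)]
  have h2 : r ^ 2 + a ^ 2 ≤ 2 * r ^ 2 := by linarith
  have h3 : 0 ≤ (r - rPlus M a) * √(M ^ 2 - a ^ 2) := mul_nonneg (sub_nonneg.2 hr) hsq
  calc (r - rPlus M a) * √(M ^ 2 - a ^ 2) * (r ^ 2 + a ^ 2)
      ≤ (r - rPlus M a) * √(M ^ 2 - a ^ 2) * (2 * r ^ 2) := mul_le_mul_of_nonneg_left h2 h3
    _ = (r - rPlus M a) * (2 * √(M ^ 2 - a ^ 2)) * r ^ 2 := by ring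
    _ ≤ delta M a r * r ^ 2 := mul_le_mul_of_nonneg_right hΔ (by positivity)

namespace IsTortoiseRadius

/-- Every `r > r₊` is a value of a tortoise radius function. [folklore] -/
theorem exists_eq (hR : IsTortoiseRadius M a R) (hMa : IsSubextremal M a) {r : ℝ}
    (hr : rPlus M a < r) :
    ∃ x, R x = r := by
  obtain ⟨xlo, hxlo⟩ : ∃ x, R x < r := (hR.tendsto_atBot.eventually (gt_mem_nhds hr)).exists
  obtain ⟨xhi, hxhi⟩ : ∃ x, r < R x :=
    (hR.tendsto_atTop.eventually (eventually_gt_atTop r)).exists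
  have hlt : xlo ≤ xhi := ((hR.strictMono hMa).lt_iff_lt.1 (hxlo.trans hxhi)).le
  obtain ⟨x, -, hx⟩ := intermediate_value_Icc hlt hR.continuous.continuousOn ⟨hxlo.le, hxhi.le⟩
  exact ⟨x, hx⟩

/-- **`R(y) − R(x) ≤ y − x`** for `x ≤ y` (`dR/dx ≤ 1`). [folklore] -/
theorem sub_le (hR : IsTortoiseRadius M a R) (hMa : IsSubextremal M a) {x y : ℝ} (hxy : x ≤ y) :
    R y - R x ≤ y - x := by
  have h := (convex_Icc x y).image_sub_le_mul_sub_of_deriv_le hR.continuous.continuousOn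
    (fun t _ ↦ (hR.hasDerivAt t).differentiableAt.differentiableWithinAt) (C := 1)
    (fun t _ ↦ by rw [(hR.hasDerivAt t).deriv]; exact hR.deriv_le_one hMa t)
    x (left_mem_Icc.2 hxy) y (right_mem_Icc.2 hxy) hxy
  linarith

/-- `|R(y) − R(x)| ≤ |y − x|`. [folklore] -/
theorem abs_sub_le (hR : IsTortoiseRadius M a R) (hMa : IsSubextremal M a) (x y : ℝ) :
    |R y - R x| ≤ |y - x| := by
  rcases le_total x y with h | h
  · rw [abs_of_nonneg (sub_nonneg.2 ((hR.strictMono hMa).monotone h)),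
      abs_of_nonneg (sub_nonneg.2 h)]
    exact hR.sub_le hMa h
  · rw [abs_sub_comm, abs_of_nonneg (sub_nonneg.2 ((hR.strictMono hMa).monotone h)),
      abs_sub_comm, abs_of_nonneg (sub_nonneg.2 h)]
    exact hR.sub_le hMa h

/-- **`R(y) − R(x) ≥ q(R(x)) (y − x)`** for `x ≤ y` (`dR/dx = q(R)` is non-decreasing along the
orbit). [folklore] -/
theorem mul_sub_le (hR : IsTortoiseRadius M a R) (hMa : IsSubextremal M a) {x y : ℝ} (hxy : x ≤ y) :
    delta M a (R x) / (R x ^ 2 + a ^ 2) * (y - x) ≤ R y - R x := by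
  have hM := hMa.pos
  have h := (convex_Icc x y).mul_sub_le_image_sub_of_le_deriv hR.continuous.continuousOn
    (fun t _ ↦ (hR.hasDerivAt t).differentiableAt.differentiableWithinAt)
    (C := delta M a (R x) / (R x ^ 2 + a ^ 2))
    (fun t ht ↦ by
      rw [interior_Icc] at ht
      rw [(hR.hasDerivAt t).deriv]
      have hMx : M < R x := lt_of_le_of_lt (M_le_rPlus M a) (hR.rPlus_lt x)
      refine delta_div_mono hM.le (hM.trans hMx) ((le_of_lt hMa).trans hMx.le) ?_
      exact (hR.strictMono hMa).monotone ht.1.le)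
    x (left_mem_Icc.2 hxy) y (right_mem_Icc.2 hxy) hxy
  linarith

/-- **Exponential depth bound**: `(R(c) − r₊) exp(−(c − x)/M) ≤ R(x) − r₊` for `x ≤ c` — along the
orbit `d/dx log(R − r₊) = (R − r₋)/(R² + a²) ≤ 1/M`. (Going a tortoise distance `ℓ` towards the
horizon shrinks `r − r₊` at most by the factor `e^{−ℓ/M}`.) [folklore] -/
theorem sub_rPlus_ge (hR : IsTortoiseRadius M a R) (hMa : IsSubextremal M a) {x c : ℝ}
    (hxc : x ≤ c) :
    (R c - rPlus M a) * Real.exp (-(c - x) / M) ≤ R x - rPlus M a := by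
  have hM := hMa.pos
  have haM : |a| ≤ M := le_of_lt hMa
  set G : ℝ → ℝ := fun t ↦ Real.log (R t - rPlus M a) with hG
  have hpos : ∀ t, 0 < R t - rPlus M a := fun t ↦ sub_pos.2 (hR.rPlus_lt t)
  have hrm : 0 ≤ rMinus M a := by
    unfold rMinus
    have : √(M ^ 2 - a ^ 2) ≤ M := by
      rw [Real.sqrt_le_left hM.le]; nlinarith [sq_nonneg a]
    linarith
  have hGd : ∀ t, HasDerivAt G ((R t - rMinus M a) / (R t ^ 2 + a ^ 2)) t := by
    intro t
    have h := ((hR.hasDerivAt t).sub_const (rPlus M a)).log (hpos t).ne'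
    refine h.congr_deriv ?_
    rw [delta_eq_mul haM]
    field_simp [(hpos t).ne']
  have hmvt := (convex_Icc x c).image_sub_le_mul_sub_of_deriv_le
    (fun t _ ↦ (hGd t).continuousAt.continuousWithinAt)
    (fun t _ ↦ (hGd t).differentiableAt.differentiableWithinAt) (C := 1 / M)
    (fun t _ ↦ by
      rw [(hGd t).deriv]
      have hRt : M < R t := lt_of_le_of_lt (M_le_rPlus M a) (hR.rPlus_lt t)
      have hR0 : 0 < R t := hM.trans hRt
      rw [div_le_div_iff₀ (by positivity) hM]
      nlinarith [sq_nonneg a, hrm])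
    x (left_mem_Icc.2 hxc) c (right_mem_Icc.2 hxc) hxc
  -- `log(R c − r₊) − log(R x − r₊) ≤ (c − x)/M`
  have hlog : Real.log (R c - rPlus M a) ≤ Real.log (R x - rPlus M a) + (c - x) / M := by
    have : G c - G x ≤ 1 / M * (c - x) := hmvt
    simp only [hG] at this
    have e : 1 / M * (c - x) = (c - x) / M := by ring
    linarith
  have h1 : R c - rPlus M a ≤ (R x - rPlus M a) * Real.exp ((c - x) / M) := by
    have h := Real.exp_le_exp.2 hlog
    rwa [Real.exp_log (hpos c), Real.exp_add, Real.exp_log (hpos x)] at h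
  have h2 : 0 < Real.exp (-(c - x) / M) := Real.exp_pos _
  calc (R c - rPlus M a) * Real.exp (-(c - x) / M)
      ≤ (R x - rPlus M a) * Real.exp ((c - x) / M) * Real.exp (-(c - x) / M) :=
        mul_le_mul_of_nonneg_right h1 h2.le
    _ = R x - rPlus M a := by
        rw [mul_assoc, ← Real.exp_add, show (c - x) / M + -(c - x) / M = 0 by ring, Real.exp_zero,
          mul_one]

end IsTortoiseRadius

end Tortoise

/-! ### The multipliers of the `𝓖_♮` current as `r*`-profiles -/

section TrapMultipliers

variable {M a : ℝ} {R : ℝ → ℝ} {c L C ρ θ x : ℝ}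

/-- **The multipliers `f, ŷ` (and `h = 0`, `χ₂ = 1`, `χ₁ = 0`) of the current `Q = Q^f + ϟ^ŷ − EQ^T`
of DRSR arXiv:1402.7034, proof of Prop. 8.6.1, as explicit functions of `x = r*`**:
`f = A₀ + A₁Φ((x − c)/L)/I`, an affine image of the clipped-linear profile of
`KerrSharpSupProfiles.lean` centred at `c` with length scale `L` (`A₀ = 0, A₁ = 1`: `f` from `−1` to
`1` through `0` at `c = r*(r_max)`, the case `r₃ < R_dec`; `A₀ = A₁ = ½`: `f` from `0` to `1`, the
case `r₃ ≥ R_dec`), and `y = Y ∘ R` the horizon weight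
`trapWeight C ρ θ` read along the tortoise radius function `R`, with its `r*`-derivative
`y' = (dY/dr)(R) Δ(R)/(R² + a²)`.
[cite: DafermosRodnianskiShlapentokhrothman2014, Prop. 8.6.1 (proof)] -/
def trapMultipliers (M a c L A₀ A₁ C ρ θ : ℝ) (R : ℝ → ℝ) : Multipliers where
  f x := A₀ + A₁ * (sharpMultipliers c L 1 0).f x
  f' x := A₁ * (sharpMultipliers c L 1 0).f' x
  f'' x := A₁ * (sharpMultipliers c L 1 0).f'' x
  f''' x := A₁ * (sharpMultipliers c L 1 0).f''' x
  h := 0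
  h' := 0
  h'' := 0
  y x := trapWeight C ρ θ (R x)
  y' x := trapWeightDeriv C ρ θ (R x) * (delta M a (R x) / (R x ^ 2 + a ^ 2))
  χ₁ := 0
  χ₁' := 0
  χ₂ := fun _ ↦ 1
  χ₂' := 0

/-- The derivative relations of `trapMultipliers` along a tortoise radius function. [folklore] -/
theorem hasDerivs_trapMultipliers (hR : IsTortoiseRadius M a R) (c L A₀ A₁ C ρ θ : ℝ) :
    (trapMultipliers M a c L A₀ A₁ C ρ θ R).HasDerivs where
  df x := (((hasDerivs_sharpMultipliers c L 1 0).df x).const_mul A₁).const_add A₀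
  df' x := ((hasDerivs_sharpMultipliers c L 1 0).df' x).const_mul A₁
  df'' x := ((hasDerivs_sharpMultipliers c L 1 0).df'' x).const_mul A₁
  dh x := hasDerivAt_const x (0 : ℝ)
  dh' x := hasDerivAt_const x (0 : ℝ)
  dy x := (hasDerivAt_trapWeight C ρ θ (R x)).comp x (hR.hasDerivAt x)
  dχ₁ x := hasDerivAt_const x (0 : ℝ)
  dχ₂ x := hasDerivAt_const x (1 : ℝ)

/-- `f = A₀ + A₁f♯`, `f' = A₁f♯'`, `f'' = A₁f♯''`, `f''' = A₁f♯'''` with `f♯` the profile of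
`sharpMultipliers c L 1 0`. [folklore] -/
theorem trapMultipliers_f (M a c L A₀ A₁ C ρ θ : ℝ) (R : ℝ → ℝ) (x : ℝ) :
    (trapMultipliers M a c L A₀ A₁ C ρ θ R).f x = A₀ + A₁ * (sharpMultipliers c L 1 0).f x ∧
      (trapMultipliers M a c L A₀ A₁ C ρ θ R).f' x = A₁ * (sharpMultipliers c L 1 0).f' x ∧
      (trapMultipliers M a c L A₀ A₁ C ρ θ R).f'' x = A₁ * (sharpMultipliers c L 1 0).f'' x ∧
      (trapMultipliers M a c L A₀ A₁ C ρ θ R).f''' x = A₁ * (sharpMultipliers c L 1 0).f''' x :=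
  ⟨rfl, rfl, rfl, rfl⟩

/-- `y = Y(R)`. [folklore] -/
theorem trapMultipliers_y (M a c L A₀ A₁ C ρ θ : ℝ) (R : ℝ → ℝ) (x : ℝ) :
    (trapMultipliers M a c L A₀ A₁ C ρ θ R).y x = trapWeight C ρ θ (R x) := rfl

/-- `y' = (dY/dr)(R) Δ(R)/(R² + a²)`. [folklore] -/
theorem trapMultipliers_y' (M a c L A₀ A₁ C ρ θ : ℝ) (R : ℝ → ℝ) (x : ℝ) :
    (trapMultipliers M a c L A₀ A₁ C ρ θ R).y' x =
      trapWeightDeriv C ρ θ (R x) * (delta M a (R x) / (R x ^ 2 + a ^ 2)) := rfl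

/-- `h = h' = h'' = 0`, `χ₁ = χ₁' = χ₂' = 0`, `χ₂ = 1`. [folklore] -/
theorem trapMultipliers_consts (M a c L A₀ A₁ C ρ θ : ℝ) (R : ℝ → ℝ) (x : ℝ) :
    (trapMultipliers M a c L A₀ A₁ C ρ θ R).h x = 0 ∧
      (trapMultipliers M a c L A₀ A₁ C ρ θ R).h' x = 0 ∧
      (trapMultipliers M a c L A₀ A₁ C ρ θ R).h'' x = 0 ∧
      (trapMultipliers M a c L A₀ A₁ C ρ θ R).χ₁ x = 0 ∧
      (trapMultipliers M a c L A₀ A₁ C ρ θ R).χ₁' x = 0 ∧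
      (trapMultipliers M a c L A₀ A₁ C ρ θ R).χ₂ x = 1 ∧
      (trapMultipliers M a c L A₀ A₁ C ρ θ R).χ₂' x = 0 :=
  ⟨rfl, rfl, rfl, rfl, rfl, rfl, rfl⟩

/-- **End limits at `r* = ∞`**: `f → A₀ + A₁`, `y → 0`, `χ₁ → 0`, `χ₂ → 1` (`L > 0`, `θ ≥ 0`; all
profiles are eventually constant: `f = A₀ + A₁`, `f' = f'' = 0` for `x ≥ c + 2L`, and `y = 0` once
`R ≥ ρ + θ`).
[cite: DafermosRodnianskiShlapentokhrothman2014, Thm. 8.1] -/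
theorem endLimits_trapMultipliers_atTop (hR : IsTortoiseRadius M a R) (hL : 0 < L) (hθ : 0 ≤ θ)
    (c A₀ A₁ C ρ : ℝ) :
    (trapMultipliers M a c L A₀ A₁ C ρ θ R).EndLimits atTop (A₀ + A₁) 0 0 1 where
  tendsto_f := by
    apply tendsto_const_nhds.congr'
    filter_upwards [eventually_ge_atTop (c + 2 * L)] with x hx
    show A₀ + A₁ = A₀ + A₁ * (sharpMultipliers c L 1 0).f x
    rw [sharpMultipliers_f_eq_one (d := 1) (A := 0) hL hx, mul_one]
  tendsto_f' := ⟨0, by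
    apply tendsto_const_nhds.congr'
    filter_upwards [eventually_ge_atTop (c + 2 * L)] with x hx
    show (0 : ℝ) = A₁ * (sharpMultipliers c L 1 0).f' x
    rw [sharpMultipliers_f'_eq_zero (d := 1) (A := 0) hL
      (by rw [abs_of_nonneg (by linarith)]; linarith), mul_zero]⟩
  tendsto_f'' := by
    apply tendsto_const_nhds.congr'
    filter_upwards [eventually_ge_atTop (c + 2 * L)] with x hx
    show (0 : ℝ) = A₁ * (sharpMultipliers c L 1 0).f'' x
    rw [sharpMultipliers_f''_eq_zero (d := 1) (A := 0) hL
      (by rw [abs_of_nonneg (by linarith)]; linarith), mul_zero]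
  tendsto_h := ⟨0, tendsto_const_nhds⟩
  tendsto_h' := tendsto_const_nhds
  tendsto_y := by
    apply tendsto_const_nhds.congr'
    filter_upwards [hR.eventually_le (ρ + θ)] with x hx
    exact (trapWeight_of_ge hx hθ C).symm
  tendsto_χ₁ := tendsto_const_nhds
  tendsto_χ₂ := tendsto_const_nhds

/-- **End limits at the horizon end `r* = −∞`**: `f → A₀ − A₁`, `y → Y(r₊)`, `χ₁ → 0`, `χ₂ → 1`
(`L > 0`). [cite: DafermosRodnianskiShlapentokhrothman2014, Thm. 8.1] -/
theorem endLimits_trapMultipliers_atBot (hR : IsTortoiseRadius M a R) (hL : 0 < L)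
    (c A₀ A₁ C ρ θ : ℝ) :
    (trapMultipliers M a c L A₀ A₁ C ρ θ R).EndLimits atBot (A₀ - A₁) (trapWeight C ρ θ (rPlus M a))
      0 1 where
  tendsto_f := by
    apply tendsto_const_nhds.congr'
    filter_upwards [eventually_le_atBot (c - 2 * L)] with x hx
    show A₀ - A₁ = A₀ + A₁ * (sharpMultipliers c L 1 0).f x
    rw [sharpMultipliers_f_eq_neg_one (d := 1) (A := 0) hL hx]; ring
  tendsto_f' := ⟨0, by
    apply tendsto_const_nhds.congr'
    filter_upwards [eventually_le_atBot (c - 2 * L)] with x hx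
    show (0 : ℝ) = A₁ * (sharpMultipliers c L 1 0).f' x
    rw [sharpMultipliers_f'_eq_zero (d := 1) (A := 0) hL
      (by rw [abs_of_nonpos (by linarith)]; linarith), mul_zero]⟩
  tendsto_f'' := by
    apply tendsto_const_nhds.congr'
    filter_upwards [eventually_le_atBot (c - 2 * L)] with x hx
    show (0 : ℝ) = A₁ * (sharpMultipliers c L 1 0).f'' x
    rw [sharpMultipliers_f''_eq_zero (d := 1) (A := 0) hL
      (by rw [abs_of_nonpos (by linarith)]; linarith), mul_zero]
  tendsto_h := ⟨0, tendsto_const_nhds⟩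
  tendsto_h' := tendsto_const_nhds
  tendsto_y := ((continuous_trapWeight C ρ θ).tendsto (rPlus M a)).comp hR.tendsto_atBot
  tendsto_χ₁ := tendsto_const_nhds
  tendsto_χ₂ := tendsto_const_nhds

/-- The source term of the `𝓖_♮` current is the printed right-hand side
`−2f Re(u'H̄) − f' Re(uH̄) + Eω Im(Hū) − 2ŷ Re(u'H̄)` of (thisisspartaEst) (DRSR arXiv:1402.7034,
Prop. 8.6.1; the sign of the `ŷ`-term is that of the `ϟ`-identity of §7 and of Theorem 8.1's
`H·(f, h, y, χ)·(u, u')`). [cite: DafermosRodnianskiShlapentokhrothman2014, Prop. 8.6.1] -/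
theorem combinedSource_trapMultipliers (M a c L A₀ A₁ C ρ θ ω ϖ E : ℝ) (R : ℝ → ℝ) (u u₁ H : ℝ → ℂ)
    (x : ℝ) :
    combinedSource ω ϖ E (trapMultipliers M a c L A₀ A₁ C ρ θ R) u u₁ H x =
      -(2 * (trapMultipliers M a c L A₀ A₁ C ρ θ R).f x * ⟪H x, u₁ x⟫_ℝ) -
        (trapMultipliers M a c L A₀ A₁ C ρ θ R).f' x * ⟪H x, u x⟫_ℝ -
        2 * trapWeight C ρ θ (R x) * ⟪H x, u₁ x⟫_ℝ +
        E * (ω * (H x * (starRingEnd ℂ) (u x)).im) := by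
  simp only [combinedSource, trapMultipliers, Pi.zero_apply]
  ring

/-- **The bulk of the `𝓖_♮` current**:
`Q' + source = (2f' + ŷ')|u'|² + (−fV' − ½f''' + ŷ'(ω² − V) − ŷV')|u|²` — the integrand
"`ŷ'(|u'|² + (ω² − V)|u|²) − ŷV'|u|² + 2f'|u'|² − (fV' + ½f''')|u|²`" of the identity in the
proof of DRSR arXiv:1402.7034, Prop. 8.6.1.
[cite: DafermosRodnianskiShlapentokhrothman2014, Prop. 8.6.1 (proof)] -/
theorem combinedBulk_trapMultipliers (M a c L A₀ A₁ C ρ θ ω ϖ E : ℝ) (R : ℝ → ℝ) (V V' : ℝ → ℝ)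
    (u u₁ : ℝ → ℂ) (x : ℝ) :
    combinedBulk ω ϖ E V V' (trapMultipliers M a c L A₀ A₁ C ρ θ R) u u₁ x =
      (2 * (trapMultipliers M a c L A₀ A₁ C ρ θ R).f' x +
            (trapMultipliers M a c L A₀ A₁ C ρ θ R).y' x) * ‖u₁ x‖ ^ 2 +
        (-((trapMultipliers M a c L A₀ A₁ C ρ θ R).f x * V' x) -
            1 / 2 * (trapMultipliers M a c L A₀ A₁ C ρ θ R).f''' x +
            (trapMultipliers M a c L A₀ A₁ C ρ θ R).y' x * (ω ^ 2 - V x) -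
            trapWeight C ρ θ (R x) * V' x) * ‖u x‖ ^ 2 := by
  simp only [combinedBulk, trapMultipliers, Pi.zero_apply]
  ring

end TrapMultipliers

end Kerr

end Literature.Geometry.Lorentzian

end
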